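import Literature.Combinatorics.Enumerative.PartitionNumberUpperBound
import Mathlib.Analysis.SpecificLimits.Basic
import HarnessLib

/-!
# van Lint–Wilson's bound `p(n) < π/√(6(n−1)) · e^{π√(2n/3)}` for the partition function

[cite: VanLintWilson1992, Ch. 15, Theorem 15.7 ("For `n > 2` we have
`p(n) < π/√(6(n−1)) · e^{π√(2n/3)}`") with its proof (held scan
`book:van-lint2001-course-combinatorics` = 1992 first edition, p0089)]

The tree's `PartitionNumberUpperBound` proves Apostol's `p(n) ≤ e^{π√(2n/3)}` from
`p(n) xⁿ ≤ F_n(x) = ∏_{k ≤ n} (1 − x^k)⁻¹ ≤ exp(π²/6 · x/(1−x))`.  Van Lint–Wilson gain the factor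
`π/√(6(n−1))` from the monotonicity of `p`: "Since `p(n)` is increasing, we have
`P(t) > p(n) tⁿ (1 − t)⁻¹`", then `log p(n) < π²/(6u) + n log(1+u) + log(u/(1+u))
≤ π²/(6u) + (n−1)u + log u` with `t = (1+u)⁻¹`, `u = π/√(6(n−1))`.

Formalised (theorems only, for Mathlib's `Nat.Partition`, `p(n) = Fintype.card (Nat.Partition n)`):
* `card_partition_mono` — `p` is monotone (add parts equal to `1`);
* `sum_card_partition_mul_pow_le_prod` — the generating-function inequality for initial
  segments, `∑_{k ≤ N} p(k) x^k ≤ ∏_{k=1}^{N} (1 − x^k)⁻¹` (`0 ≤ x < 1`), by injecting all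
  partitions of all `k ≤ N` into multiplicity vectors, as in the tree's single-`n` version;
* `card_partition_mul_pow_le_mul_exp` — `p(n) xⁿ ≤ (1 − x) exp(π²/6 · x/(1−x))` (`0 < x < 1`),
  the limit `N → ∞` of `p(n) xⁿ (1 + x + ⋯ + x^{N−n}) ≤ ∑_{n ≤ k ≤ N} p(k) x^k ≤ F_N(x)`;
* `card_partition_le_mul_exp` — `p(n) ≤ u (1+u)^{n−1} exp(π²/(6u)) ≤ u · exp((n−1)u + π²/(6u))`
  for `u > 0`;
* `card_partition_le` — with `u = π/√(6(n−1))`: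
  **`p(n) ≤ π/√(6(n−1)) · e^{π√(2(n−1)/3)}`** for `n ≥ 2`, and hence the printed
  `card_partition_lt` — **`p(n) < π/√(6(n−1)) · e^{π√(2n/3)}`** (`n ≥ 2`; the book states it for
  `n > 2`).
-/

noncomputable section

open Finset Real Filter
open scoped BigOperators Topology

namespace Literature.Combinatorics.Enumerative.PartitionNumberUpperBoundSharpened

open Literature.Combinatorics.Enumerative

/-! ## Monotonicity of `p` -/

/-- [cite: VanLintWilson1992, Ch. 15, Theorem 15.7, proof ("Since `p(n)` is increasing")
(p0089)]  `p(n) ≤ p(m)` for `n ≤ m`: adding `m − n` parts equal to `1` is injective. -/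
theorem card_partition_mono {n m : ℕ} (h : n ≤ m) :
    Fintype.card (Nat.Partition n) ≤ Fintype.card (Nat.Partition m) := by
  classical
  let f : Nat.Partition n → Nat.Partition m := fun p =>
    { parts := p.parts + Multiset.replicate (m - n) 1
      parts_pos := fun {i} hi => by
        rcases Multiset.mem_add.1 hi with hi | hi
        · exact p.parts_pos hi
        · rw [Multiset.eq_of_mem_replicate hi]; exact Nat.one_pos
      parts_sum := by
        rw [Multiset.sum_add, p.parts_sum, Multiset.sum_replicate, smul_eq_mul, mul_one]
        omega }
  refine Fintype.card_le_of_injective f fun p q hpq => ?_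
  have : p.parts = q.parts := by
    have := congrArg Nat.Partition.parts hpq
    exact add_right_cancel this
  exact Nat.Partition.ext this

/-! ## The generating-function inequality for initial segments -/

/-- [folklore] The parts of `p ⊢ k`, `k ≤ N`, lie in `[1, N]`. -/
private theorem mem_Icc_of_mem_parts' {N k : ℕ} (hk : k ≤ N) (p : Nat.Partition k) {m : ℕ}
    (hm : m ∈ p.parts) : m ∈ Icc 1 N :=
  mem_Icc.2 ⟨p.parts_pos hm, (Nat.Partition.le_of_mem_parts hm).trans hk⟩

/-- [folklore] `∑_{m=1}^{N} c_m(p) · m = k` for `p ⊢ k`, `k ≤ N`. -/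
private theorem sum_Icc_count_mul {N k : ℕ} (hk : k ≤ N) (p : Nat.Partition k) :
    ∑ m ∈ Icc 1 N, p.parts.count m * m = k := by
  classical
  have := Finset.sum_multiset_count_of_subset p.parts (Icc 1 N) fun m hm =>
    mem_Icc_of_mem_parts' hk p (Multiset.mem_toFinset.mp hm)
  simp_rw [smul_eq_mul] at this
  rw [← this]
  exact p.parts_sum

/-- [cite: VanLintWilson1992, Ch. 15, Theorem 15.7, proof ("`P(t) > p(n) tⁿ (1−t)⁻¹`", the
left side being `∑ p(k) t^k`) (p0089)]  **`∑_{k=0}^{N} p(k) x^k ≤ ∏_{k=1}^{N} (1 − x^k)⁻¹`** for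
`0 ≤ x < 1`: all partitions of all `k ≤ N` inject into the multiplicity vectors
`[1, N] → {0, …, N}`, the vector of `p ⊢ k` having weight `∏_m (x^m)^{c_m} = x^k`. -/
theorem sum_card_partition_mul_pow_le_prod {x : ℝ} (hx0 : 0 ≤ x) (hx1 : x < 1) (N : ℕ) :
    ∑ k ∈ range (N + 1), (Fintype.card (Nat.Partition k) : ℝ) * x ^ k ≤
      ∏ k ∈ Icc 1 N, (1 - x ^ k)⁻¹ := by
  classical
  -- all partitions of all `k ≤ N`
  set PP : Finset (Σ k : ℕ, Nat.Partition k) :=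
    (range (N + 1)).sigma fun _ => univ with hPP
  -- multiplicity vectors and weights
  set mult : (Σ k : ℕ, Nat.Partition k) → (Icc 1 N → ℕ) :=
    fun q i => q.2.parts.count (i : ℕ) with hmult
  set w : (Icc 1 N → ℕ) → ℝ := fun c => ∏ i : Icc 1 N, (x ^ (i : ℕ)) ^ c i with hw
  have hw_nonneg : ∀ c, 0 ≤ w c := fun c =>
    Finset.prod_nonneg fun i _ => pow_nonneg (pow_nonneg hx0 _) _
  have hwq : ∀ q ∈ PP, w (mult q) = x ^ q.1 := by
    rintro ⟨k, p⟩ hq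
    have hk : k ≤ N := Nat.lt_succ_iff.1 (mem_range.1 (Finset.mem_sigma.1 hq).1)
    simp only [hw, hmult]
    simp_rw [← pow_mul]
    rw [Finset.prod_pow_eq_pow_sum, Finset.sum_coe_sort (Icc 1 N) fun i => i * p.parts.count i]
    congr 1
    exact (Finset.sum_congr rfl fun m _ => mul_comm _ _).trans (sum_Icc_count_mul hk p)
  have hinj : Set.InjOn mult PP := by
    rintro ⟨k, p⟩ hq ⟨k', p'⟩ hq' he
    have hk : k ≤ N := Nat.lt_succ_iff.1 (mem_range.1 (Finset.mem_sigma.1 hq).1)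
    have hk' : k' ≤ N := Nat.lt_succ_iff.1 (mem_range.1 (Finset.mem_sigma.1 hq').1)
    have hparts : p.parts = p'.parts := by
      refine Multiset.ext.mpr fun m => ?_
      by_cases hm : m ∈ Icc 1 N
      · exact congr_fun he ⟨m, hm⟩
      · rw [Multiset.count_eq_zero.mpr fun h' => hm (mem_Icc_of_mem_parts' hk p h'),
          Multiset.count_eq_zero.mpr fun h' => hm (mem_Icc_of_mem_parts' hk' p' h')]
    have hkk : k = k' := by rw [← p.parts_sum, ← p'.parts_sum, hparts]
    subst hkk
    rw [Nat.Partition.ext hparts]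
  set box : Finset (Icc 1 N → ℕ) := Fintype.piFinset fun _ => range (N + 1) with hbox
  have himage : PP.image mult ⊆ box := by
    intro c hc
    obtain ⟨⟨k, p⟩, hq, rfl⟩ := mem_image.mp hc
    have hk : k ≤ N := Nat.lt_succ_iff.1 (mem_range.1 (Finset.mem_sigma.1 hq).1)
    exact Fintype.mem_piFinset.mpr fun i =>
      mem_range.mpr (Nat.lt_succ_of_le ((count_parts_le p i).trans hk))
  calc ∑ k ∈ range (N + 1), (Fintype.card (Nat.Partition k) : ℝ) * x ^ k
      = ∑ q ∈ PP, x ^ q.1 := by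
        rw [hPP, Finset.sum_sigma]
        refine Finset.sum_congr rfl fun k _ => ?_
        show _ = ∑ _q : Nat.Partition k, x ^ k
        rw [Finset.sum_const, Finset.card_univ, nsmul_eq_mul]
    _ = ∑ q ∈ PP, w (mult q) := Finset.sum_congr rfl fun q hq => (hwq q hq).symm
    _ = ∑ c ∈ PP.image mult, w c := (Finset.sum_image hinj).symm
    _ ≤ ∑ c ∈ box, w c :=
        Finset.sum_le_sum_of_subset_of_nonneg himage fun c _ _ => hw_nonneg c
    _ = ∏ i : Icc 1 N, ∑ c ∈ range (N + 1), (x ^ (i : ℕ)) ^ c := by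
        rw [hbox, Finset.prod_univ_sum]
    _ ≤ ∏ i : Icc 1 N, (1 - x ^ (i : ℕ))⁻¹ := by
        refine Finset.prod_le_prod (fun i _ => Finset.sum_nonneg fun c _ =>
          pow_nonneg (pow_nonneg hx0 _) _) fun i _ => ?_
        have hi : 1 ≤ (i : ℕ) := (mem_Icc.mp i.2).1
        exact sum_range_pow_le_inv_one_sub (pow_nonneg hx0 _)
          ((pow_le_of_le_one hx0 hx1.le (by omega)).trans_lt hx1) (N + 1)
    _ = ∏ k ∈ Icc 1 N, (1 - x ^ k)⁻¹ := Finset.prod_coe_sort (Icc 1 N) fun k => (1 - x ^ k)⁻¹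

/-! ## `p(n) xⁿ ≤ (1 − x) · exp(π²/6 · x/(1−x))` -/

/-- [cite: VanLintWilson1992, Ch. 15, Theorem 15.7, proof ("Since `p(n)` is increasing, we have
`P(t) > p(n) tⁿ (1 − t)⁻¹`. By combining the two inequalities …") (p0089)]  For `0 < x < 1`:
`p(n) xⁿ ≤ (1 − x) · exp(π²/6 · x/(1−x))`. -/
theorem card_partition_mul_pow_le_mul_exp {x : ℝ} (hx0 : 0 < x) (hx1 : x < 1) (n : ℕ) :
    (Fintype.card (Nat.Partition n) : ℝ) * x ^ n ≤
      (1 - x) * Real.exp (π ^ 2 / 6 * (x / (1 - x))) := by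
  set E := Real.exp (π ^ 2 / 6 * (x / (1 - x))) with hE
  have h1x : 0 < 1 - x := sub_pos.2 hx1
  -- for every `M`: `p(n) xⁿ · ∑_{j<M} x^j ≤ E`
  have hfin : ∀ M : ℕ, (Fintype.card (Nat.Partition n) : ℝ) * x ^ n *
      ∑ j ∈ range M, x ^ j ≤ E := by
    intro M
    calc (Fintype.card (Nat.Partition n) : ℝ) * x ^ n * ∑ j ∈ range M, x ^ j
        = ∑ j ∈ range M, (Fintype.card (Nat.Partition n) : ℝ) * x ^ (n + j) := by
          rw [Finset.mul_sum]
          exact Finset.sum_congr rfl fun j _ => by rw [pow_add]; ring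
      _ ≤ ∑ j ∈ range M, (Fintype.card (Nat.Partition (n + j)) : ℝ) * x ^ (n + j) :=
          Finset.sum_le_sum fun j _ => mul_le_mul_of_nonneg_right
            (by exact_mod_cast card_partition_mono (Nat.le_add_right n j)) (pow_nonneg hx0.le _)
      _ = ∑ k ∈ (range M).map (addLeftEmbedding n),
            (Fintype.card (Nat.Partition k) : ℝ) * x ^ k := by
          rw [Finset.sum_map]; rfl
      _ ≤ ∑ k ∈ range (n + M + 1), (Fintype.card (Nat.Partition k) : ℝ) * x ^ k := by
          refine Finset.sum_le_sum_of_subset_of_nonneg (fun k hk => ?_) fun k _ _ =>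
            mul_nonneg (Nat.cast_nonneg _) (pow_nonneg hx0.le _)
          obtain ⟨j, hj, rfl⟩ := Finset.mem_map.1 hk
          rw [mem_range] at hj ⊢
          simp only [addLeftEmbedding_apply]
          omega
      _ ≤ ∏ k ∈ Icc 1 (n + M), (1 - x ^ k)⁻¹ :=
          sum_card_partition_mul_pow_le_prod hx0.le hx1 (n + M)
      _ ≤ E := prod_inv_one_sub_pow_le_exp hx0 hx1 (n + M)
  -- let `M → ∞`: `∑_{j<M} x^j → (1 − x)⁻¹`
  have hlim : Tendsto (fun M : ℕ => (Fintype.card (Nat.Partition n) : ℝ) * x ^ n *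
      ∑ j ∈ range M, x ^ j) atTop
      (𝓝 ((Fintype.card (Nat.Partition n) : ℝ) * x ^ n * (1 - x)⁻¹)) :=
    ((hasSum_geometric_of_lt_one hx0.le hx1).tendsto_sum_nat).const_mul _
  have hle : (Fintype.card (Nat.Partition n) : ℝ) * x ^ n * (1 - x)⁻¹ ≤ E :=
    le_of_tendsto' hlim hfin
  rwa [← div_eq_mul_inv, div_le_iff₀ h1x, mul_comm E] at hle

/-! ## The bound for `p(n)` -/

/-- [cite: VanLintWilson1992, Ch. 15, Theorem 15.7, proof ("`log p(n) < π²/6 · u⁻¹ + n log(1+u)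
+ log(u/(1+u))`", "Therefore `log p(n) < π²/6 · u⁻¹ + (n−1)u + log u`") (p0089)]  For every
`u > 0` and `n ≥ 1`: `p(n) ≤ u · exp((n−1) u + π²/(6u))`. -/
theorem card_partition_le_mul_exp {u : ℝ} (hu : 0 < u) {n : ℕ} (hn : 1 ≤ n) :
    (Fintype.card (Nat.Partition n) : ℝ) ≤ u * Real.exp ((n - 1 : ℝ) * u + π ^ 2 / (6 * u)) := by
  -- `x = 1/(1+u)`: `x/(1-x) = 1/u`, `1 - x = u x`, `x⁻¹ = 1 + u ≤ e^u`
  set x : ℝ := (1 + u)⁻¹ with hx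
  have h1u : 0 < 1 + u := by positivity
  have hx0 : 0 < x := inv_pos.mpr h1u
  have hx1 : x < 1 := inv_lt_one_of_one_lt₀ (by linarith)
  have h1x : 1 - x = u * x := by
    rw [hx]
    field_simp
    ring
  have hxu : x / (1 - x) = 1 / u := by
    rw [h1x, mul_comm, ← div_div, div_self hx0.ne']
  have h := card_partition_mul_pow_le_mul_exp hx0 hx1 n
  rw [hxu, h1x] at h
  -- divide by `xⁿ = x · x^{n-1}` and use `x⁻¹ = 1 + u ≤ e^u`
  have hxn : 0 < x ^ n := pow_pos hx0 n
  obtain ⟨m, rfl⟩ : ∃ m, n = m + 1 := ⟨n - 1, by omega⟩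
  have hm : ((m + 1 : ℕ) : ℝ) - 1 = m := by push_cast; ring
  rw [hm]
  have hxinv : x⁻¹ = 1 + u := by rw [hx, inv_inv]
  have key : (Fintype.card (Nat.Partition (m + 1)) : ℝ) ≤
      u * (1 + u) ^ m * Real.exp (π ^ 2 / 6 * (1 / u)) := by
    have h' : (Fintype.card (Nat.Partition (m + 1)) : ℝ) ≤
        u * x * Real.exp (π ^ 2 / 6 * (1 / u)) / x ^ (m + 1) := (le_div_iff₀ hxn).2 h
    refine h'.trans (le_of_eq ?_)
    have hx0' : x ≠ 0 := hx0.ne'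
    clear_value x
    rw [pow_succ x m, ← hxinv, inv_pow, div_eq_iff (mul_ne_zero (pow_ne_zero m hx0') hx0')]
    have e : u * (x ^ m)⁻¹ * Real.exp (π ^ 2 / 6 * (1 / u)) * (x ^ m * x) =
        u * x * Real.exp (π ^ 2 / 6 * (1 / u)) * ((x ^ m)⁻¹ * x ^ m) := by ring
    rw [e, inv_mul_cancel₀ (pow_ne_zero m hx0'), mul_one]
  refine key.trans ?_
  have hE : Real.exp (π ^ 2 / 6 * (1 / u)) = Real.exp (π ^ 2 / (6 * u)) := by
    rw [mul_one_div, div_div]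
  rw [hE, Real.exp_add, ← mul_assoc]
  refine mul_le_mul_of_nonneg_right (mul_le_mul_of_nonneg_left ?_ hu.le) (Real.exp_pos _).le
  rw [Real.exp_nat_mul]
  exact pow_le_pow_left₀ h1u.le (by linarith [Real.add_one_le_exp u]) m

/-- [cite: VanLintWilson1992, Ch. 15, Theorem 15.7, proof ("We get the required inequality by
substituting `u = π {6(n−1)}^{-1/2}`") (p0089)]  **`p(n) ≤ π/√(6(n−1)) · e^{π√(2(n−1)/3)}`** for
`n ≥ 2` (the value of van Lint–Wilson's bound before the final weakening `n − 1 ≤ n` in the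
exponent). -/
theorem card_partition_le {n : ℕ} (hn : 2 ≤ n) :
    (Fintype.card (Nat.Partition n) : ℝ) ≤
      π / Real.sqrt (6 * (n - 1 : ℝ)) * Real.exp (π * Real.sqrt (2 * (n - 1 : ℝ) / 3)) := by
  have hn1 : (0 : ℝ) < n - 1 := by
    have : (2 : ℝ) ≤ n := by exact_mod_cast hn
    linarith
  have hss : Real.sqrt (6 * (n - 1 : ℝ)) * Real.sqrt (6 * (n - 1 : ℝ)) = 6 * (n - 1 : ℝ) :=
    Real.mul_self_sqrt (by positivity)
  have hsq : Real.sqrt (2 * (n - 1 : ℝ) / 3) = Real.sqrt (6 * (n - 1 : ℝ)) / 3 := by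
    rw [eq_div_iff (by norm_num : (3 : ℝ) ≠ 0)]
    rw [show (6 : ℝ) * (n - 1) = 3 ^ 2 * (2 * (n - 1) / 3) by ring, Real.sqrt_mul (by positivity),
      Real.sqrt_sq (by norm_num : (0 : ℝ) ≤ 3)]
    ring
  set s : ℝ := Real.sqrt (6 * (n - 1 : ℝ)) with hs
  have hs0 : 0 < s := Real.sqrt_pos.2 (by positivity)
  have hu : 0 < π / s := div_pos Real.pi_pos hs0
  refine (card_partition_le_mul_exp hu (by omega : 1 ≤ n)).trans (le_of_eq ?_)
  congr 1
  rw [hsq]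
  have hn6 : ((n : ℝ) - 1) = s * s / 6 := by rw [hss]; ring
  rw [hn6]
  field_simp
  ring

/-- [cite: VanLintWilson1992, Ch. 15, Theorem 15.7 ("For `n > 2` we have
`p(n) < π/√(6(n−1)) · e^{π√(2n/3)}`") (p0089)]  **Van Lint–Wilson, Theorem 15.7** (here for all
`n ≥ 2`). -/
theorem card_partition_lt {n : ℕ} (hn : 2 ≤ n) :
    (Fintype.card (Nat.Partition n) : ℝ) <
      π / Real.sqrt (6 * (n - 1 : ℝ)) * Real.exp (π * Real.sqrt (2 * n / 3)) := by
  refine (card_partition_le hn).trans_lt ?_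
  have hn1 : (0 : ℝ) < n - 1 := by
    have : (2 : ℝ) ≤ n := by exact_mod_cast hn
    linarith
  have hpos : 0 < π / Real.sqrt (6 * (n - 1 : ℝ)) :=
    div_pos Real.pi_pos (Real.sqrt_pos.2 (by positivity))
  refine mul_lt_mul_of_pos_left ?_ hpos
  rw [Real.exp_lt_exp]
  refine mul_lt_mul_of_pos_left ?_ Real.pi_pos
  exact Real.sqrt_lt_sqrt (by positivity) (by linarith)

end Literature.Combinatorics.Enumerative.PartitionNumberUpperBoundSharpened

end
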